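import Summits.HodgeConjecture.HodgeConjecture.Theorems.PeriodsPoliceClassicalBridgeBettiHardLefschetz
import Literature.AlgebraicGeometry.Motives.BettiHodgeClassicalPin
import Literature.AlgebraicGeometry.Motives.Sweep1
import Literature.AlgebraicGeometry.Motives.VarietiesProjectiveSpaceProofs
import Literature.AlgebraicGeometry.HodgeTheory.HodgeTypeExteriorProduct
import Literature.AlgebraicGeometry.HodgeTheory.HodgeTypeVanishing
import Literature.AlgebraicGeometry.HodgeTheory.HodgeFiltration
import Mathlib.LinearAlgebra.BilinearForm.TensorProduct
import HarnessLib

/-!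
# The first Hodge–Riemann bilinear relation for EVERY pinned Betti–Hodge realization datum over `ℂ`

Crux `ClassicalBridge` (stmt-HodgeConjecture-14652, route `HodgeConjecture/PeriodsPolice`), registered line
`Cruxes/ClassicalBridge/Lines/pieces_split.lean`, piece P3 with its own birth skeleton
`Cruxes/ClassicalBridge/Lines/p3_birth.lean`. This file closes the registered stub

* **`stub_bettiHodgeRiemannI`** (signature VERBATIM): `∀ B : BettiHodgeData ℂ, B.IsClassicalHodge → HodgeRiemannIStatement B`
  — if `B.hodge` IS the Hodge structure of `X^an` (the pin `BettiHodgeData.IsClassicalHodge`: the Hodge filtration of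
  `B.hodge hX i` is the preimage of `Fʳ Hⁱ(X^an) = ⊕_{p ≥ r} H^{p,i-p}` under the comparison `Φ_A`), then for `X` smooth
  projective of dimension `n`, a hyperplane class `η`, `i + r = n`, `x ∈ Fᵖ Hⁱ` and `y ∈ F^{i+1-p} Hⁱ` (complexified),
  the complexified Lefschetz form vanishes: `Q_ℂ(x, y) = tr_ℂ(x ∪ Lʳ_η y) = 0` (Voisin I, Thm. 6.32 (i) / Lemma 7.30).

Proof (the P3 skeleton's plan, both of its stubs proved on the way):
1. `lefschetzForm_baseChange_eq`: `Q_ℂ(x, y) = ℓ(z)` for the `ℂ`-linear `ℓ = tr ⊗ ℂ` and the class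
   `z = (a, b ↦ a ∪ Lʳ_η b)_ℂ (x, y) ∈ ℂ ⊗ H²ⁿ_W(X)` (pure-tensor check) — P3's `stub_lefschetzForm_eq_trace_of_fil`, type part;
2. `comparison_cupLefschetz_baseChange`: the complexified comparison `Ψ = B.comparison : ℂ ⊗ H•_W(X) → H•(X(ℂ); ℂ)`,
   `c ⊗ t ↦ c • ι(B.iso t)`, sends `z` to `Ψ x ∪ Lʳ_{Φ η} (Ψ y)` (file `…BettiHardLefschetz`: `Φ` is multiplicative and
   intertwines the Lefschetz iterates); `Ψ` is injective (`comparison_injective`: `ℂ ⊗_ℚ Hⁱ(X(ℂ); ℚ) → Hⁱ(X(ℂ); ℂ)` is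
   injective, `ringChangeBaseChange_injective`, from the tree's `linearIndependent_ringChange_iff`);
3. `HodgeModel.map₂_cupProduct_hodgeFiltration_le`: on `X^an` the Hodge filtration is multiplicative,
   `Fᵃ Hᵏ ∪ Fᵇ Hˡ ⊆ F^{a+b} H^{k+l}` (the cup product adds Hodge types — the tree's PROVED `CupPreservesHodgeType`,
   `cupPreservesHodgeType_of_multiplicative_deRham` with de Rham's theorem `exists_deRhamIsoFamily_holds` — and the
   independence of the Hodge model `hodgePQ_independent_of_hodgeModel_holds`), hence `Lʳ` raises `Fᵇ` to `F^{b+r}` for a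
   class in `F¹ H²` (`HodgeModel.lefschetzPowTo_mem_hodgeFiltration`); and `Fᵐ Hᵏ(X^an) = 0` for `m > n`
   (`HodgeModel.hodgeFiltration_eq_bot_of_dim_lt`, from `HodgeModel.hodgePQ_eq_bot_of_lt`: no `(p,q)`-forms with `p > n`)
   — P3's `stub_hodgeFiltration_top` in the form `F^{n+1} H^{2n}(X^an) = 0`;
4. `bettiHodgeRiemannI`: through the pin, `Φ_A x ∈ Fᵃ`, `Φ_A y ∈ Fᵇ` with `a = max(p, 0)`, `b = max(i + 1 - p, 0)`,
   `a + b ≥ i + 1` (`F⁰ = ⊤`, `HodgeModel.hodgeFiltration_zero`), and `Φ_A(1 ⊗ η) ∈ F¹ H²` because a hyperplane class is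
   algebraic, hence a `B`-Hodge class (`algebraicClasses_le_hodgeClasses`, Voisin I Prop. 11.20); so `Φ_A z ∈
   F^{a+b+r} H^{2n}(X^an) = 0` (`a + b + r ≥ n + 1`), `z = 0` by injectivity, and `Q_ℂ(x, y) = ℓ(0) = 0`.

No definition, no named fact, no sorry. References: [VoisinHodgeI2002] Thm. 6.32 (i), Lemma 7.30, §7.1.1, Prop. 11.20;
[Deligne2000] §1; [HatcherAT2002] §3.1 Thm. 3.2, §3.2 Prop. 3.10.
-/

noncomputable section

-- every declaration of this problem lives in `Summit.HodgeConjecture.HodgeConjecture.…` (summit = sub-problem)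
set_option linter.dupNamespace false

open CategoryTheory AlgebraicGeometry
open scoped TensorProduct
open Literature.AlgebraicGeometry.Motives Literature.AlgebraicGeometry.HodgeTheory
open Literature.AlgebraicTopology.SingularHomology Literature.Geometry.Kaehler

namespace Summit.HodgeConjecture.HodgeConjecture.Theorems.ClassicalBridge

/-! ## Injectivity of the complexified comparison -/

/-- **`ℂ ⊗_ℚ Hᵏ(Y; ℚ) → Hᵏ(Y; ℂ)` is injective** for every space `Y` (`c ⊗ a ↦ c • ι(a)`): the image of a `ℚ`-basis
of `Hᵏ(Y; ℚ)` is `ℂ`-linearly independent (the tree's `linearIndependent_ringChange_iff`, Voisin I §7.1.1; Hatcher Thm.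
3.2). [cite: VoisinHodgeI2002, §7.1.1] [cite: HatcherAT2002, §3.1 Thm. 3.2] -/
theorem ringChangeBaseChange_injective (Y : Type) [TopologicalSpace Y] (k : ℕ) :
    Function.Injective (ringChangeBaseChange Y k) := by
  let b := Module.Free.chooseBasis ℚ (singularCohomology ℚ ℚ Y k)
  let b' := Algebra.TensorProduct.basis ℂ b
  refine LinearMap.injective_of_linearIndependent (v := b') b'.span_eq ?_
  have hcomp : (ringChangeBaseChange Y k) ∘ b' = fun i ↦
      singularCohomology.ringChange (algebraMap ℚ ℂ) Y k (b i) := by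
    funext i
    simp only [Function.comp_apply, b', Algebra.TensorProduct.basis_apply, ringChangeBaseChange_tmul,
      one_smul]
  rw [hcomp]
  exact (linearIndependent_ringChange_iff _).2 b.linearIndependent

variable (B : BettiHodgeData ℂ)

/-- **The complexified comparison `Ψ = B.comparison X i : ℂ ⊗_ℚ Hⁱ_W(X) → Hⁱ(X(ℂ); ℂ)` is injective**
(`B.iso ⊗ ℂ` is bijective, `ℂ` is flat over `ℚ`, and `ringChangeBaseChange_injective`). [cite: VoisinHodgeI2002, §7.1.1] -/
theorem comparison_injective (X : SchemeOver ℂ) (i : ℕ) : Function.Injective (B.comparison X i) := by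
  rw [BettiHodgeData.comparison, LinearMap.coe_comp]
  refine (ringChangeBaseChange_injective (ComplexPoints X) i).comp ?_
  rw [LinearMap.baseChange_eq_ltensor]
  exact Module.Flat.lTensor_preserves_injective_linearMap _ (B.isoObj X i).injective

/-- **`Φ_A = φ^* ∘ Ψ : ℂ ⊗_ℚ Hⁱ_W(X) → Hⁱ(X^an; ℂ)` is injective** for every Hodge model `A` (`φ : X^an → X(ℂ)` is a
homeomorphism, `HodgeModel.pullback_injective`). [cite: SerreGAGA1956, §2] -/
theorem modelComparison_injective {n : ℕ} {X : SchemeOver ℂ} (A : HodgeModel n X) (i : ℕ) :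
    Function.Injective (B.modelComparison A i) :=
  fun _ _ h ↦ comparison_injective B X i (A.pullback_injective i h)

/-! ## The complexified Lefschetz form factors through the complexified cup–Lefschetz map -/

/-- **`Q_ℂ(x, y) = (tr ⊗ ℂ)((a, b ↦ a ∪ Lʳ_η b)_ℂ (x, y))`**: the base change to `ℂ` of the Lefschetz form
`Q(a, b) = tr(a ∪ Lʳ_η b)` of a pre-Weil cohomology is the `ℂ`-linear functional `ℓ = rid ∘ (tr ⊗ ℂ)` applied to the base
change of the bilinear map `(a, b) ↦ a ∪ Lʳ_η b` (check on pure tensors: both give `tr(m ∪ Lʳ_η m') · c c'`).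
[cite: VoisinHodgeI2002, (6.11) before Thm. 6.32] [cite: Kleiman1968, §3] -/
theorem lefschetzForm_baseChange_eq {n : ℕ} (X : SchemeOver ℂ) (η : B.W.obj X 2) {i r j : ℕ}
    (hj : i + 2 * r = j) (hn : i + j = 2 * n) (x y : ℂ ⊗[ℚ] B.W.obj X i) :
    (B.W.lefschetzForm X (n := n) η i r j hj hn).baseChange ℂ x y =
      TensorProduct.AlgebraTensorModule.rid ℚ ℂ ℂ ((B.W.trace X n).baseChange ℂ
        (LinearMap.BilinMap.baseChange ℂ ((B.W.cup hn).compl₂ (B.W.lefschetzPow X η r i j hj)) x y)) := by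
  induction x using TensorProduct.induction_on with
  | zero => simp only [map_zero, LinearMap.zero_apply]
  | add x₁ x₂ h₁ h₂ => simp only [map_add, LinearMap.add_apply, h₁, h₂]
  | tmul c m =>
    induction y using TensorProduct.induction_on with
    | zero => simp only [map_zero]
    | add y₁ y₂ h₁ h₂ => simp only [map_add, h₁, h₂]
    | tmul c' m' =>
      simp only [LinearMap.BilinForm.baseChange_tmul, LinearMap.BilinMap.baseChange_tmul,
        LinearMap.baseChange_tmul, TensorProduct.AlgebraTensorModule.rid_tmul]
      rfl

/-- **`Ψ((a, b ↦ a ∪ Lʳ_η b)_ℂ (x, y)) = Ψ x ∪ Lʳ_{Φ η} (Ψ y)`** for the complexified comparison `Ψ = B.comparison`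
(`c ⊗ t ↦ c • Φ t`, `Φ = ι ∘ B.iso`), `X` smooth projective: `Φ` is multiplicative (`toComplexBetti_cup`) and intertwines
`Lʳ_η` with the singular `lefschetzPowTo (Φ η) r` (`toComplexBetti_lefschetzPow`); extend `ℂ`-bilinearly.
[cite: Kleiman1968, §1.2 Example (1) and §1.4] [cite: HatcherAT2002, §3.2 p. 215] -/
theorem comparison_cupLefschetz_baseChange {n : ℕ} {X : SchemeOver ℂ} (hX : IsSmoothProjective n X)
    (η : B.W.obj X 2) {i r j m : ℕ} (hj : i + 2 * r = j) (hm : i + j = m) (x y : ℂ ⊗[ℚ] B.W.obj X i) :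
    B.comparison X m (LinearMap.BilinMap.baseChange ℂ ((B.W.cup hm).compl₂ (B.W.lefschetzPow X η r i j hj)) x y) =
      cupProduct hm (B.comparison X i x)
        (lefschetzPowTo (B.toComplexBetti X 2 η) r i j hj (B.comparison X i y)) := by
  induction x using TensorProduct.induction_on with
  | zero => simp only [map_zero, LinearMap.zero_apply]
  | add x₁ x₂ h₁ h₂ => simp only [map_add, LinearMap.add_apply, h₁, h₂]
  | tmul c t =>
    induction y using TensorProduct.induction_on with
    | zero => simp only [map_zero]
    | add y₁ y₂ h₁ h₂ => simp only [map_add, h₁, h₂]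
    | tmul c' t' =>
      rw [LinearMap.BilinMap.baseChange_tmul, BettiHodgeData.comparison_tmul,
        BettiHodgeData.comparison_tmul, BettiHodgeData.comparison_tmul, LinearMap.compl₂_apply,
        ← BettiHodgeData.toComplexBetti_apply, ← BettiHodgeData.toComplexBetti_apply,
        ← BettiHodgeData.toComplexBetti_apply, toComplexBetti_cup, toComplexBetti_lefschetzPow hX η r hj,
        map_smul, map_smul, LinearMap.smul_apply, map_smul, smul_smul]

/-! ## The Hodge filtration of `X^an` is multiplicative and stops at `Fⁿ` -/

/-- Transport of `lefschetzPowTo` along a continuous map (the tree's `lefschetzPow_map` with an explicit target degree).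
[cite: HatcherAT2002, Prop. 3.10] -/
theorem map_lefschetzPowTo {Y Y' : Type} [TopologicalSpace Y] [TopologicalSpace Y'] (f : C(Y', Y))
    (κ : singularCohomology ℂ ℂ Y 2) (r : ℕ) {k m : ℕ} (hm : k + 2 * r = m) (c : singularCohomology ℂ ℂ Y k) :
    singularCohomology.map ℂ ℂ f m (lefschetzPowTo κ r k m hm c) =
      lefschetzPowTo (singularCohomology.map ℂ ℂ f 2 κ) r k m hm (singularCohomology.map ℂ ℂ f k c) := by
  subst hm
  exact lefschetzPow_map f κ r k c

/-- **The Hodge filtration of `X^an` is multiplicative**: `Fᵃ Hᵏ(X^an; ℂ) ∪ Fᵇ Hˡ(X^an; ℂ) ⊆ F^{a+b} H^{k+l}(X^an; ℂ)`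
for every Hodge model `A` of a smooth projective `X` (`Fᵃ = ⊕_{p ≥ a} H^{p,k-p}`; the cup product of classes of types
`(p,q)` and `(p',q')` is of type `(p+p', q+q')` — the tree's `CupPreservesHodgeType`, proved from the multiplicative
de Rham theorem — read back in the model `A` by the independence of the Hodge model). Voisin I, Lemma 7.30 (in the
de Rham–Dolbeault form `Fᵖ ∧ F^{p'} ⊆ F^{p+p'}`). [cite: VoisinHodgeI2002, Lemma 7.30 and §7.1.1] -/
theorem _root_.Literature.AlgebraicGeometry.HodgeTheory.HodgeModel.map₂_cupProduct_hodgeFiltration_le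
    {n : ℕ} {X : SchemeOver ℂ} (A : HodgeModel n X) (hX : IsSmoothProjective n X) {k l s : ℕ}
    (h : k + l = s) (a b : ℕ) :
    Submodule.map₂ (cupProduct (R := ℂ) (X := A.carrier) h) (A.hodgeFiltration k a)
        (A.hodgeFiltration l b) ≤ A.hodgeFiltration s (a + b) := by
  have hcup : CupPreservesHodgeType n X := cupPreservesHodgeType_of_multiplicative_deRham
    (fun E _ _ _ ↦ Literature.NumberTheory.Transcendental.exists_deRhamIsoFamily_holds E) hX
  simp only [HodgeModel.hodgeFiltration, Submodule.map₂_iSup_left, Submodule.map₂_iSup_right,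
    iSup_le_iff]
  intro p q hpq hap p' q' hpq' hbp'
  refine Submodule.map₂_le.2 fun u hu v hv ↦ ?_
  obtain ⟨c, rfl⟩ := A.pullback_surjective k u
  obtain ⟨d, rfl⟩ := A.pullback_surjective l v
  obtain ⟨A', hA'⟩ := hcup h ⟨A, hu⟩ ⟨A, hv⟩
  have hA := hodgePQ_independent_of_hodgeModel_holds n X hX A' A s _ _ _ hA'
  rw [cupProduct_map] at hA
  exact A.hodgePQ_le_hodgeFiltration (by omega) (by omega) hA

/-- **`Fᵐ Hᵏ(X^an; ℂ) = 0` for `m > n = dim X`**: every `H^{p,q}` with `p ≥ m > n` vanishes (no `(p,q)`-forms with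
`p > n`, the tree's `HodgeModel.hodgePQ_eq_bot_of_lt`). In particular `F^{n+1} H^{2n}(X^an) = 0`.
[cite: VoisinHodgeI2002, §6.1.3 and §7.1.1] -/
theorem _root_.Literature.AlgebraicGeometry.HodgeTheory.HodgeModel.hodgeFiltration_eq_bot_of_dim_lt
    {n : ℕ} {X : SchemeOver ℂ} (A : HodgeModel n X) (hX : IsSmoothProjective n X) (k : ℕ) {m : ℕ}
    (hm : n < m) : A.hodgeFiltration k m = ⊥ := by
  refine eq_bot_iff.2 (iSup_le fun p ↦ iSup_le fun q ↦ iSup_le fun _ ↦ iSup_le fun hmp ↦ ?_)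
  rw [A.hodgePQ_eq_bot_of_lt hX k (Or.inl (lt_of_lt_of_le hm hmp))]

/-- **`Lʳ_κ` raises the Hodge filtration by `r`** for a class `κ ∈ F¹ H²(X^an; ℂ)`: `v ∈ Fᵇ Hᵏ ⟹ Lʳ_κ v ∈ F^{b+r} H^{k+2r}`
(multiplicativity of the filtration, `r` times). [cite: VoisinHodgeI2002, Rem. 6.27 and Lemma 7.30] -/
theorem _root_.Literature.AlgebraicGeometry.HodgeTheory.HodgeModel.lefschetzPowTo_mem_hodgeFiltration
    {n : ℕ} {X : SchemeOver ℂ} (A : HodgeModel n X) (hX : IsSmoothProjective n X)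
    {κ : singularCohomology ℂ ℂ A.carrier 2} (hκ : κ ∈ A.hodgeFiltration 2 1) (r : ℕ) :
    ∀ {k m : ℕ} (hm : k + 2 * r = m) {b : ℕ} {v : singularCohomology ℂ ℂ A.carrier k},
      v ∈ A.hodgeFiltration k b → lefschetzPowTo κ r k m hm v ∈ A.hodgeFiltration m (b + r) := by
  induction r with
  | zero =>
    intro k m hm b v hv
    subst hm
    simpa using hv
  | succ r ih =>
    intro k m hm b v hv
    rw [lefschetzPowTo_succ_apply κ r k (k + 2 * r) m rfl hm (by omega), lefschetzOperator_apply]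
    have h := A.map₂_cupProduct_hodgeFiltration_le hX (by omega : 2 + (k + 2 * r) = m) 1 (b + r)
      (Submodule.apply_mem_map₂ _ hκ (ih rfl hv))
    rwa [show 1 + (b + r) = b + (r + 1) by omega] at h

/-! ## Hodge–Riemann I under the pin -/

variable {B}

/-- A hyperplane class of `B.W` is a `B`-algebraic class of codimension `1`: `η = e.ι^* cl_W(D)` with `cl_W(D)` in the
algebraic lattice of `ℙᴺ` and pull-backs preserving rational algebraic classes (Kleiman §1.2 (C), §1.4).
[cite: Kleiman1968, §1.4] -/
theorem mem_algebraicClasses_of_isHyperplaneClass {n : ℕ} {X : SchemeOver ℂ} (hX : IsSmoothProjective n X)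
    {η : B.W.obj X 2} (hη : B.W.IsHyperplaneClass X η) : η ∈ B.W.algebraicClasses X 1 := by
  refine B.W.ratAlgebraicClasses_le_algebraicClasses X 1 ?_
  obtain ⟨e, D, hD, -, rfl⟩ := hη
  exact B.W.pullback_ratAlgebraicClasses_le hX (isSmoothProjective_projectiveSpace_holds ℂ e.n) e.ι 1
    ⟨_, B.W.algebraicLattice_le_ratAlgebraicClasses _ 1 (B.W.cycleMap_mem_algebraicLattice _ 1 hD), rfl⟩

/-- Under the pin, membership in `Fᵖ` for an INTEGER `p` gives membership in `F^{max(p,0)}`: `F⁰(B) = Φ_A⁻¹(F⁰ Hⁱ(X^an)) =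
Φ_A⁻¹(⊤)` (`HodgeModel.hodgeFiltration_zero`). [cite: VoisinHodgeI2002, §7.1.1] -/
theorem mem_F_toNat_of_mem_F (hB : B.IsClassicalHodge) {n : ℕ} {X : SchemeOver ℂ} (hX : IsSmoothProjective n X)
    (A : HodgeModel n X) {i : ℕ} {p : ℤ} {x : ℂ ⊗[ℚ] B.W.obj X i} (hx : x ∈ (B.hodge hX i).F p) :
    x ∈ (B.hodge hX i).F (p.toNat : ℕ) := by
  rcases le_or_gt 0 p with hp | hp
  · rwa [Int.toNat_of_nonneg hp]
  · rw [Int.toNat_eq_zero.2 hp.le, ← hB.comap_hodgeFiltration hX A i 0, A.hodgeFiltration_zero,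
      Submodule.comap_top]
    trivial

/-- **The first Hodge–Riemann bilinear relation for every pinned Betti–Hodge realization datum over `ℂ`** (Voisin I,
Thm. 6.32 (i) / Lemma 7.30, read through the pin `IsClassicalHodge`): for `X` smooth projective of dimension `n`, a
hyperplane class `η`, `i + r = n`, `x ∈ Fᵖ Hⁱ` and `y ∈ F^{i+1-p} Hⁱ`, `Q_ℂ(x, y) = 0`. The class
`z = (x ∪ Lʳ_η y)_ℂ ∈ ℂ ⊗ H²ⁿ_W(X)` maps under the injective `Φ_A` to `Φ_A x ∪ Lʳ_{Φ_A(1⊗η)} Φ_A y ∈ F^{a+b+r} H^{2n}(X^an) = 0`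
(`a + b ≥ i + 1`, `η ∈ F¹` as an algebraic class), so `z = 0` and `Q_ℂ(x, y) = (tr ⊗ ℂ)(z) = 0`.
[cite: VoisinHodgeI2002, Thm. 6.32 (i) and Lemma 7.30] [cite: Deligne2000, §1] -/
theorem bettiHodgeRiemannI (hB : B.IsClassicalHodge) : HodgeRiemannIStatement B := by
  intro n X hX η hη i r j hr hj p x y hx hy
  obtain ⟨A⟩ := nonempty_hodgeModel_holds (n := n) (X := X) hX
  -- indices: `x ∈ Fᵃ`, `y ∈ Fᵇ` with natural `a + b ≥ i + 1`
  have hxa := (hB.mem_F_iff hX A i p.toNat x).1 (mem_F_toNat_of_mem_F hB hX A hx)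
  have hyb := (hB.mem_F_iff hX A i ((i : ℤ) + 1 - p).toNat y).1 (mem_F_toNat_of_mem_F hB hX A hy)
  have hab : n < p.toNat + ((((i : ℤ) + 1 - p).toNat) + r) := by
    have h₁ := Int.self_le_toNat p
    have h₂ := Int.self_le_toNat ((i : ℤ) + 1 - p)
    omega
  -- `Φ_A (1 ⊗ η) ∈ F¹ H²(X^an)`: `η` is algebraic, hence a `B`-Hodge class
  have hη1 : A.pullback 2 (B.toComplexBetti X 2 η) ∈ A.hodgeFiltration 2 1 := by
    have hηF : HodgeStructure.ofRat η ∈ (B.hodge hX 2).F ((1 : ℕ) : ℤ) :=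
      (HodgeStructure.mem_hodgeClasses_iff _ _ _).1
        (B.algebraicClasses_le_hodgeClasses hX 1 (mem_algebraicClasses_of_isHyperplaneClass hX hη))
    have h := (hB.mem_F_iff hX A 2 1 _).1 hηF
    rwa [BettiHodgeData.modelComparison_ofRat] at h
  -- the class `z` and its image `Φ_A z ∈ F^{a+b+r} H^{2n}(X^an) = 0`
  have hn2 : i + j = 2 * n := by omega
  have hz : B.modelComparison A (2 * n)
      (LinearMap.BilinMap.baseChange ℂ ((B.W.cup hn2).compl₂ (B.W.lefschetzPow X η r i j hj)) x y) ∈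
        A.hodgeFiltration (2 * n) (p.toNat + ((((i : ℤ) + 1 - p).toNat) + r)) := by
    rw [BettiHodgeData.modelComparison_apply, comparison_cupLefschetz_baseChange B hX η hj hn2,
      cupProduct_map, map_lefschetzPowTo]
    exact A.map₂_cupProduct_hodgeFiltration_le hX hn2 _ _
      (Submodule.apply_mem_map₂ _ hxa (A.lefschetzPowTo_mem_hodgeFiltration hX hη1 r hj hyb))
  rw [A.hodgeFiltration_eq_bot_of_dim_lt hX (2 * n) hab, Submodule.mem_bot] at hz
  have hz0 := modelComparison_injective B A (2 * n) (hz.trans (map_zero _).symm)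
  rw [lefschetzForm_baseChange_eq, hz0, map_zero, map_zero]

variable (B) in
/-- **Stub `stub_bettiHodgeRiemannI` of crux `ClassicalBridge` (piece P3 `BettiHodgeRiemannI`; registered signature,
verbatim):** the first Hodge–Riemann bilinear relation for every pinned Betti–Hodge realization datum over `ℂ`
(`bettiHodgeRiemannI`). [cite: VoisinHodgeI2002, Thm. 6.32 (i) and Lemma 7.30] -/
theorem stub_bettiHodgeRiemannI :
    ∀ B : BettiHodgeData ℂ, B.IsClassicalHodge → HodgeRiemannIStatement B :=
  fun _ hB ↦ bettiHodgeRiemannI hB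

end Summit.HodgeConjecture.HodgeConjecture.Theorems.ClassicalBridge

end
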